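import Mathlib.Analysis.SpecialFunctions.Trigonometric.Bounds
import Mathlib.Analysis.Complex.Trigonometric
import Mathlib.Analysis.Normed.Group.AddCircle
import Mathlib.Algebra.Field.GeomSum
import HarnessLib

/-!
# Route `GreenTaoLevelTwo`, crux `GITwo` (stmt-Parity-21275), line `birth`, stub `stub_cyclicInverse`:
# the geometric-series bound `‖Σ_{n<M} e(nθ)‖ ≤ 1/(2‖θ‖_{ℝ/ℤ})` (for GT08a arXiv Lemma 38)

Twenty-fifth helper file toward the XL stub `stub_cyclicInverse` (B. Green, T. Tao, *An inverse
theorem for the Gowers `U³(G)` norm*, arXiv:math/0503014, Thm. 68 = PEMS 51 (2008) Thm. 12.8).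
Block B7 of the printed proof (local Fourier analysis on regular Bohr sets, arXiv Lemmas 38–41)
starts from the generalized Fourier decay estimate (arXiv Lemma 38), whose analytic input is "by
the geometric series formula, `|𝔼_{−M≤n≤M} e(nφ(y))|` is bounded by `2/(M‖φ(y)‖_{ℝ/ℤ})`".  This
def-free file lands that input:

* `two_mul_norm_coe_le_abs_sin` — Jordan: `2‖θ‖_{ℝ/ℤ} ≤ |sin(πθ)|` (`‖·‖` the norm of
  `UnitAddCircle`, i.e. the distance to the nearest integer);
* `norm_exp_two_pi_mul_I_sub_one` — `‖e(θ) − 1‖ = 2|sin(πθ)|`;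
* `norm_sum_range_exp_mul_le` — `‖Σ_{n<M} e(nθ)‖ · 2‖θ‖_{ℝ/ℤ} ≤ 1`.

References: [GreenTao2008U3Inverse] arXiv:math/0503014, proof of Lemma 38.
-/

noncomputable section

namespace Summit.Parity.GeneralizedHardyLittlewood.GreenTaoLevelTwoGITwoCyclicInverse

open Finset Real

/-- **Jordan's inequality on the circle**: `2‖θ‖_{ℝ/ℤ} ≤ |sin(πθ)|`. [folklore] -/
theorem two_mul_norm_coe_le_abs_sin (t : ℝ) :
    2 * ‖((t : ℝ) : UnitAddCircle)‖ ≤ |Real.sin (π * t)| := by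
  rw [UnitAddCircle.norm_eq]
  have hu : |t - round t| ≤ 1 / 2 := abs_sub_round t
  have hper : |Real.sin (π * t)| = |Real.sin (π * (t - round t))| := by
    have : π * t = π * (t - round t) + ((round t : ℤ) : ℝ) * π := by ring
    rw [this, Real.sin_add_int_mul_pi, abs_mul, abs_zpow, abs_neg, abs_one, one_zpow, one_mul]
  rw [hper]
  set u : ℝ := t - round t with hu_def
  rcases le_or_gt 0 u with h | h
  · rw [abs_of_nonneg h]
    rw [abs_of_nonneg h] at hu
    have h1 : 2 / π * (π * u) ≤ Real.sin (π * u) :=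
      Real.mul_le_sin (by positivity) (by nlinarith [Real.pi_pos])
    have h2 : 2 / π * (π * u) = 2 * u := by field_simp
    rw [h2] at h1
    exact h1.trans (le_abs_self _)
  · rw [abs_of_neg h]
    rw [abs_of_neg h] at hu
    have h1 : 2 / π * (π * (-u)) ≤ Real.sin (π * (-u)) :=
      Real.mul_le_sin (by nlinarith [Real.pi_pos]) (by nlinarith [Real.pi_pos])
    have h2 : 2 / π * (π * (-u)) = 2 * (-u) := by field_simp
    rw [h2, mul_neg, mul_neg, Real.sin_neg] at h1
    rw [mul_neg]
    exact h1.trans (neg_le_abs _)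

/-- `‖e(θ) − 1‖ = 2|sin(πθ)|`. [folklore] -/
theorem norm_exp_two_pi_mul_I_sub_one (θ : ℝ) :
    ‖Complex.exp (2 * π * Complex.I * θ) - 1‖ = 2 * |Real.sin (π * θ)| := by
  have h : Complex.exp (2 * π * Complex.I * θ) = Complex.exp (Complex.I * ((2 * π * θ : ℝ) : ℂ)) := by
    congr 1; push_cast; ring
  rw [h, Complex.norm_exp_I_mul_ofReal_sub_one, Real.norm_eq_abs, abs_mul, abs_two]
  congr 2; ring

/-- **The geometric-series bound**: `‖Σ_{n<M} e(nθ)‖ · 2‖θ‖_{ℝ/ℤ} ≤ 1`, i.e.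
`‖Σ_{n<M} e(nθ)‖ ≤ 1/(2‖θ‖_{ℝ/ℤ})` for `θ ∉ ℤ`. [cite: GreenTao2008U3Inverse, proof of Lemma 38] -/
theorem norm_sum_range_exp_mul_le (θ : ℝ) (M : ℕ) :
    ‖∑ n ∈ Finset.range M, Complex.exp (2 * π * Complex.I * (n * θ))‖ *
        (2 * ‖((θ : ℝ) : UnitAddCircle)‖) ≤ 1 := by
  by_cases hθ : ‖((θ : ℝ) : UnitAddCircle)‖ = 0
  · rw [hθ, mul_zero, mul_zero]; exact zero_le_one
  set q : ℂ := Complex.exp (2 * π * Complex.I * θ) with hq_def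
  have hq : ∀ n : ℕ, Complex.exp (2 * π * Complex.I * (n * θ)) = q ^ n := by
    intro n
    rw [hq_def, ← Complex.exp_nat_mul]
    congr 1; ring
  have hsin : 0 < |Real.sin (π * θ)| :=
    lt_of_lt_of_le (by positivity) (two_mul_norm_coe_le_abs_sin θ)
  have hq1 : q ≠ 1 := by
    intro h1
    have := norm_exp_two_pi_mul_I_sub_one θ
    rw [← hq_def, h1, sub_self, norm_zero] at this
    linarith
  have hnorm : ‖q - 1‖ = 2 * |Real.sin (π * θ)| := norm_exp_two_pi_mul_I_sub_one θ
  have hqn : ‖q‖ = 1 := by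
    rw [hq_def]
    have : (2 * π * Complex.I * θ : ℂ) = ((2 * π * θ : ℝ) : ℂ) * Complex.I := by push_cast; ring
    rw [this, Complex.norm_exp_ofReal_mul_I]
  rw [sum_congr rfl fun n _ => hq n, geom_sum_eq hq1, norm_div, hnorm]
  have hnum : ‖q ^ M - 1‖ ≤ 2 := by
    calc ‖q ^ M - 1‖ ≤ ‖q ^ M‖ + ‖(1 : ℂ)‖ := norm_sub_le _ _
      _ = 2 := by rw [norm_pow, hqn, one_pow, norm_one]; norm_num
  have hjordan := two_mul_norm_coe_le_abs_sin θ
  rw [div_mul_eq_mul_div, div_le_one (by positivity)]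
  calc ‖q ^ M - 1‖ * (2 * ‖((θ : ℝ) : UnitAddCircle)‖) ≤ 2 * |Real.sin (π * θ)| := by
        have h0 : 0 ≤ 2 * ‖((θ : ℝ) : UnitAddCircle)‖ := by positivity
        nlinarith [norm_nonneg (q ^ M - 1)]
    _ = 2 * |Real.sin (π * θ)| := rfl

end Summit.Parity.GeneralizedHardyLittlewood.GreenTaoLevelTwoGITwoCyclicInverse
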